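import Literature.AnabelianGeometry.EtaleTheta.FrobenioidThetaDivisors
import Literature.AlgebraicGeometry.Frobenioids.DivisorMonoidCategoryTheoreticity
import HarnessLib

/-!
# [EtTh] Prop. 5.3's "isomorphism of divisor monoids induced by `Ψ`" READ AS [FrdI] Thm. 4.9 — the stub predicate
# `DivisorTransportStub.IsInducedBy` INSTANTIATED (GAP-LEDGER G-w5d245-2, LINK (a); DEFS lane, class (b))

S. Mochizuki, *The étale theta function and its Frobenioid-theoretic manifestations*, Publ. RIMS **45** (2009)
[MochizukiEtTh2009], §5, Prop. 5.3 p.325 (PDF p.99): "the automorphism `Ψ^Φ_{A_⊚}` of the monoid `Φ(A_⊚)` obtained by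
composing the isomorphism of divisor monoids induced by `Ψ` [cf. Corollary 3.8, (iii); [FrdI], Theorem 4.9] with the
isomorphism `Φ(Ψ(A_⊚)) ⥲ Φ(A_⊚)` induced by the chosen isomorphism" [cite: MochizukiEtTh2009, Prop 5.3 p.325 (PDF p.99)];
S. Mochizuki, *The geometry of Frobenioids I* (2008) [MochizukiFrdI2008], Thm. 4.9 p.88 ("there exists an isomorphism
of functors `Ψ^Φ : Φ₁ ⥲ Φ₂` lying over `Ψ`"; `Div`-compatibility: Cor. 4.11 (iv) p.92).

abc-iut cell, layer L2, seat abc-iut-w6-d052 (gen 6), row R314/R320 of abc-iut-L2-lead = GAP-LEDGER **G-w5d245-2 LINK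
(a)**.  abc-iut-L2-t4's `FrobenioidThetaDivisors.DivisorTransportStub 𝔉` (`FrobenioidThetaDivisors.lean`) is a FREE
predicate (`TODO-merge(abc-iut-L2-t3, abc-iut-L1-t3)`: "WHICH isomorphisms `Φ(A) ⥲ Φ(Ψ(A))` are the one induced by
`Ψ`"); the typed Prop. 5.3 (`GeometryOfDivisorsPreserved T 𝔓 Ψ ι e`, FACT-LIST F-2497) carries `induced : T.IsInducedBy
Ψ A_⊚ e` and says nothing more about `e` until `T` is instantiated.  THIS FILE is the instantiation over the tree's
[FrdI] Thm. 4.9 vocabulary (`PreFrobenioidData.DivisorMonoidIsoOver`, abc-iut-L1): ONE class-(b) construction over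
existing interfaces + its `Iff.rfl` unfolding; no `Prop` fact, no instance, no notation, nothing frozen edited.  The
consequences (root pair, anchored divisors, satisfiability from the tree's Thm. 4.9 suppliers) are the proof-only
companion `Discharge/Sec5DivisorTransportInducedByOfThm49.lean` (same seat).

* `DivisorTransportStub.ofThm49 𝔉` — `IsInducedBy Ψ A e` :⟺ `e` is the `A`-component of an isomorphism of functors
  `Ψ^Φ : Φ ⥲ Φ` lying over `Ψ` (natural w.r.t. pull-backs) which COMPUTES THE DIVISORS OF PRE-STEPS,
  `Ψ^Φ_X (Div φ) = Div (Ψ φ)` — exactly the output shape of the tree's Thm. 4.9 suppliers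
  (`exists_divisorMonoidIsoOver_thm49_compat_forall_ofFunctor`, printed vocabulary;
  `exists_thm49_compat_of_sufficesRightEqLeft_weak`, weak vocabulary).

HONEST FRAMING: a reading of a stub in existing vocabulary; nothing of [EtTh] §5 or [FrdI] is asserted; no side taken on
[IUTchIII] Cor. 3.12; typed ≠ proved.
-/

namespace Literature.AnabelianGeometry.EtaleTheta

open CategoryTheory Literature.AlgebraicGeometry.Frobenioids

universe w v v' u u'

variable {C : Type u} [Category.{v} C] {D : Type u'} [Category.{v'} D]

namespace FrobenioidThetaDivisors

/-! ### LINK (a): the stub predicate instantiated as [FrdI] Thm. 4.9's divisor clause -/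

/-- **`DivisorTransportStub.ofThm49 𝔉` — "the isomorphism of divisor monoids induced by `Ψ` [cf. [FrdI], Theorem 4.9]"**
(Prop. 5.3 p.325): `e : Φ(A) ⥲ Φ(Ψ(A))` IS INDUCED BY `Ψ` iff `e` is the `A`-component of an isomorphism of functors
`Ψ^Φ : Φ ⥲ Φ` lying over `Ψ` (natural w.r.t. pull-backs, `PreFrobenioidData.DivisorMonoidIsoOver`) which computes the
divisors of pre-steps, `Ψ^Φ_X (Div φ) = Div (Ψ φ)` ([FrdI] Thm. 4.9 with Cor. 4.11 (iv)'s `Div`-compatibility, in the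
tree suppliers' shape). [cite: MochizukiFrdI2008, Thm. 4.9 p.88] -/
def DivisorTransportStub.ofThm49 (𝔉 : ThetaFrobenioid.{w} C D) : DivisorTransportStub 𝔉 where
  IsInducedBy Ψ A e :=
    ∃ E : 𝔉.pre.DivisorMonoidIsoOver 𝔉.pre Ψ, E.iso A = e ∧
      ∀ ⦃X Y : C⦄ (φ : X ⟶ Y), 𝔉.pre.IsPreStep φ → E.iso X (𝔉.pre.div φ) = 𝔉.pre.div (Ψ.functor.map φ)

variable (𝔉 : ThetaFrobenioid.{w} C D)

/-- Unfolding `ofThm49`. [cite: MochizukiFrdI2008, Thm. 4.9 p.88] -/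
theorem ofThm49_isInducedBy_iff (Ψ : C ≌ C) (A : C)
    (e : 𝔉.pre.Mon (𝔉.base.obj A) ≃* 𝔉.pre.Mon (𝔉.base.obj (Ψ.functor.obj A))) :
    (DivisorTransportStub.ofThm49 𝔉).IsInducedBy Ψ A e ↔
      ∃ E : 𝔉.pre.DivisorMonoidIsoOver 𝔉.pre Ψ, E.iso A = e ∧
        ∀ ⦃X Y : C⦄ (φ : X ⟶ Y), 𝔉.pre.IsPreStep φ → E.iso X (𝔉.pre.div φ) = 𝔉.pre.div (Ψ.functor.map φ) :=
  Iff.rfl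

end FrobenioidThetaDivisors

end Literature.AnabelianGeometry.EtaleTheta
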